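import Summits.KontsevichZagierPeriods.KontsevichZagierPeriods.Theorems.HermiteRigidityRealEllipticSectorKernel

/-!
# `GenusTwoRealSectorKernel_special` — F3 / BC5 compiled WITNESS of the rung line `Lines/GenusTwoRealSectorKernel.lean`
(crux `AyoubEffectiveCubeKernel`, stmt-KontsevichZagierPeriods-18116): **`Rung 1` IS the proved floor
`RealEllipticSectorKernel`** (stmt-KontsevichZagierPeriods-10632).

`theorem rung_one : Rung 1` (no sorry) derived from the seed theorem
`Summit.KontsevichZagierPeriods.HermiteRigidity.RealEllipticSectorKernel.RealEllipticSectorKernel_proof`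
(with `q₂ = q 1`, `q₃ = q 0`, roots `e₃ = e 2 < e₂ = e 1 < e₁ = e 0`): the floor's root-free sets
`σ₁, σ₂, σ₃` are the rung's intervals (`roots_σ₁_eq` …, landed), the floor's discriminant
hypothesis is not load-bearing (`withoutDiscr_iff`, landed), the rung's rigidity at `g = 1` is the
floor's `Rigidity`, and the rung's generators at `g = 1` are the floor's `Gens`.
The rung itself is `GenusTwoRealSectorKernel := Rung 2` (rung_decl
`Summit.KontsevichZagierPeriods.KontsevichZagierPeriods.Theses.RealHyperellipticLadder.GenusTwoRealSectorKernel`);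
witness_regime: real H¹ sector of non-CM rational cubics (dim 1, genus 1); S known there in print: no; in tree: only
modulo the cite-only apex `HuberWustholzCurvePeriods`.
(The defs below are copied verbatim from the line file / the source seat's `Sketch.lean`.)
-/

noncomputable section

-- `Summit.KontsevichZagierPeriods.KontsevichZagierPeriods.…` is the tree's mandated layout (single-conjunct summit).
set_option linter.dupNamespace false

open MeasureTheory Set

namespace Summit.KontsevichZagierPeriods.KontsevichZagierPeriods.Theses.RealHyperellipticLadder

open Literature.NumberTheory.Transcendental

/-- The depressed polynomial of degree `2g+1` with leading coefficient `4` and rational lower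
coefficients: `f(x) = 4x^(2g+1) − Σ_{i<2g} qᵢ xⁱ` (`g = 1`: the Weierstrass cubic `4x³ − q₁x − q₀`). -/
def hyp (g : ℕ) (q : ℕ → ℚ) (x : ℝ) : ℝ :=
  4 * x ^ (2 * g + 1) - ∑ i ∈ Finset.range (2 * g), (q i : ℝ) * x ^ i

/-- The `j`-th bounded oval with `f > 0` (counted from the right): `(e(2j+2), e(2j+1))`. -/
def posOval (e : ℕ → ℝ) (j : ℕ) : Set (Fin 1 → ℝ) := {p | e (2 * j + 2) < p 0 ∧ p 0 < e (2 * j + 1)}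

/-- The `j`-th bounded oval with `f < 0` (counted from the right): `(e(2j+1), e(2j))`. -/
def negOval (e : ℕ → ℝ) (j : ℕ) : Set (Fin 1 → ℝ) := {p | e (2 * j + 1) < p 0 ∧ p 0 < e (2 * j)}

/-- The unbounded component `(e 0, ∞)` of `{f > 0}`. -/
def unb (e : ℕ → ℝ) : Set (Fin 1 → ℝ) := {p | e 0 < p 0}

/-- `A j k = ∫_{posOval j} x^k dx/√f`. -/
def Aval (g : ℕ) (q : ℕ → ℚ) (e : ℕ → ℝ) (j k : ℕ) : ℝ :=
  ∫ p in posOval e j, p 0 ^ k / Real.sqrt (hyp g q (p 0))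

/-- `B j k = ∫_{negOval j} x^k dx/√(−f)`. -/
def Bval (g : ℕ) (q : ℕ → ℚ) (e : ℕ → ℝ) (j k : ℕ) : ℝ :=
  ∫ p in negOval e j, p 0 ^ k / Real.sqrt (- hyp g q (p 0))

/-- RIGIDITY (inlined transcendence input, Wüstholz / Huber–Wüstholz for `End J = ℤ`): `1` and the
`4g²` numbers `A j k`, `B j k` (`j < g`, `k < 2g`) are linearly independent over the real algebraic
numbers. (`g = 1`: the floor's hypothesis on `1, J₀, J₁, K₀, K₁`.) -/
def Rigid (g : ℕ) (q : ℕ → ℚ) (e : ℕ → ℝ) : Prop :=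
  ∀ (a₀ : ℝ) (a b : ℕ → ℕ → ℝ), IsAlgebraic ℚ a₀ → (∀ j k, IsAlgebraic ℚ (a j k)) →
    (∀ j k, IsAlgebraic ℚ (b j k)) →
    a₀ + ∑ j ∈ Finset.range g, ∑ k ∈ Finset.range (2 * g),
        (a j k * Aval g q e j k + b j k * Bval g q e j k) = 0 →
    a₀ = 0 ∧ ∀ j < g, ∀ k < 2 * g, a j k = 0 ∧ b j k = 0

/-- The generators of the real hyperelliptic sector of genus `g`. -/
def Gens (g : ℕ) (q : ℕ → ℚ) (e : ℕ → ℝ) : Set KZ.FormalRep :=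
  {c | ∃ (r : KZ.IntegralRep 1) (j m : ℕ), j < g ∧ r.domain = posOval e j ∧
      EqOn r.integrand (fun p => p 0 ^ m / Real.sqrt (hyp g q (p 0))) (posOval e j) ∧
      c = KZ.of r} ∪
  {c | ∃ (r : KZ.IntegralRep 1) (j m : ℕ), j < g ∧ r.domain = negOval e j ∧
      EqOn r.integrand (fun p => p 0 ^ m / Real.sqrt (- hyp g q (p 0))) (negOval e j) ∧
      c = KZ.of r} ∪
  {c | ∃ (r : KZ.IntegralRep 1) (m : ℕ), m < g ∧ r.domain = unb e ∧
      EqOn r.integrand (fun p => p 0 ^ m / Real.sqrt (hyp g q (p 0))) (unb e) ∧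
      c = KZ.of r}

/-- Kernel form of Conjecture 1 on the subgroup generated by `S`. -/
def KernelOn (S : Set KZ.FormalRep) : Prop :=
  ∀ c ∈ AddSubgroup.closure S, KZ.eval c = 0 → c ∈ KZ.relations

/-- **The ladder.** `Rung g`: for every rational depressed polynomial of degree `2g+1` (leading
coefficient `4`) with `2g+1` ordered real roots, RIGIDITY of the `1 + 4g²` bounded-oval values
implies the kernel form on the real hyperelliptic sector. `Rung 1` = the floor
`RealEllipticSectorKernel`; `Rung 2` = the next rung. -/
def Rung (g : ℕ) : Prop :=
  ∀ (q : ℕ → ℚ) (e : ℕ → ℝ), (∀ i < 2 * g, e (i + 1) < e i) →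
    (∀ x, hyp g q x = 4 * ∏ i ∈ Finset.range (2 * g + 1), (x - e i)) →
    Rigid g q e → KernelOn (Gens g q e)

/-- The rung of the line (`Rung 2`), restated here only so that the witness file names it. -/
def GenusTwoRealSectorKernel : Prop := Rung 2

open Summit.KontsevichZagierPeriods.RealEllipticSectorKernel.Negative in
open Summit.KontsevichZagierPeriods.HermiteRigidity.RealEllipticSectorKernel in
/-- **WITNESS (F3/BC5): the floor is `Rung 1`.** [folklore] -/
theorem rung_one : Rung 1 := by
  intro q e he hf hR
  have h10 : e 1 < e 0 := he 0 (by norm_num)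
  have h21 : e 2 < e 1 := he 1 (by norm_num)
  -- the rung's polynomial at `g = 1` is the floor's cubic with `q₂ = q 1`, `q₃ = q 0`
  have hfc : ∀ x, hyp 1 q x = cubic (q 1) (q 0) x := fun x => by
    simp only [hyp, cubic, Finset.sum_range_succ, Finset.sum_range_zero]
    ring
  have hf' : ∀ x, cubic (q 1) (q 0) x = 4 * (x - e 2) * (x - e 1) * (x - e 0) := fun x => by
    have h := hf x
    simp only [Finset.prod_range_succ, Finset.prod_range_zero] at h
    rw [← hfc x, h]
    ring
  -- the floor's root-free sets are the rung's intervals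
  have hσ₁ : σ₁ (q 1) (q 0) = posOval e 0 := roots_σ₁_eq h21 h10 hf'
  have hσ₂ : σ₂ (q 1) (q 0) = negOval e 0 := roots_σ₂_eq h21 h10 hf'
  have hσ₃ : σ₃ (q 1) (q 0) = unb e := roots_σ₃_eq h21 h10 hf'
  -- the four basic values
  have hA0 : Aval 1 q e 0 0 = J₀ (q 1) (q 0) := by
    simp only [Aval, J₀, hσ₁, pow_zero, hfc]
  have hA1 : Aval 1 q e 0 1 = J₁ (q 1) (q 0) := by
    simp only [Aval, J₁, hσ₁, pow_one, hfc]
  have hB0 : Bval 1 q e 0 0 = K₀ (q 1) (q 0) := by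
    simp only [Bval, K₀, hσ₂, pow_zero, hfc]
  have hB1 : Bval 1 q e 0 1 = K₁ (q 1) (q 0) := by
    simp only [Bval, K₁, hσ₂, pow_one, hfc]
  -- the floor's rigidity from the rung's
  have hrig : Rigidity (q 1) (q 0) := by
    intro a b c d e' ha hb hc hd he' hsum
    have key := hR a (fun _ k => if k = 0 then b else c) (fun _ k => if k = 0 then d else e') ha
      (fun _ k => by by_cases hk : k = 0 <;> simp [hk, hb, hc])
      (fun _ k => by by_cases hk : k = 0 <;> simp [hk, hd, he']) (by
        simp only [Finset.sum_range_succ, Finset.sum_range_zero, zero_add, if_true,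
          one_ne_zero, if_false, hA0, hA1, hB0, hB1]
        linarith)
    obtain ⟨h0, hrest⟩ := key
    have h00 := hrest 0 (by norm_num) 0 (by norm_num)
    have h01 := hrest 0 (by norm_num) 1 (by norm_num)
    simp only [if_true, one_ne_zero, if_false] at h00 h01
    exact ⟨h0, h00.1, h01.1, h00.2, h01.2⟩
  -- the floor, without its (non-load-bearing) discriminant hypothesis
  have hK : Kernel (q 1) (q 0) := (withoutDiscr_iff.mpr RealEllipticSectorKernel_proof) (q 1) (q 0) hrig
  -- the rung's generators at `g = 1` are the floor's
  have hsub : Gens 1 q e ⊆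
      Summit.KontsevichZagierPeriods.RealEllipticSectorKernel.Negative.Gens (q 1) (q 0) := by
    rintro c ((⟨r, j, m, hj, hd, hi, rfl⟩ | ⟨r, j, m, hj, hd, hi, rfl⟩) | ⟨r, m, hm, hd, hi, rfl⟩)
    · obtain rfl : j = 0 := by omega
      refine Or.inl (Or.inl ⟨r, m, by rw [hd, hσ₁], ?_, rfl⟩)
      rw [hσ₁]; intro p hp; rw [hi hp]; simp only [hfc]
    · obtain rfl : j = 0 := by omega
      refine Or.inl (Or.inr ⟨r, m, by rw [hd, hσ₂], ?_, rfl⟩)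
      rw [hσ₂]; intro p hp; rw [hi hp]; simp only [hfc]
    · obtain rfl : m = 0 := by omega
      refine Or.inr ⟨r, by rw [hd, hσ₃], ?_, rfl⟩
      rw [hσ₃]; intro p hp; rw [hi hp]; simp only [hfc, pow_zero]
  intro c hc hc0
  exact hK c (AddSubgroup.closure_mono hsub hc) hc0

end Summit.KontsevichZagierPeriods.KontsevichZagierPeriods.Theses.RealHyperellipticLadder

end
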